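import Summits.BirchSwinnertonDyer.BirchSwinnertonDyer.Theorems.PrintCFramBottomClassIndexLawFiveLeKrizLiLocusOfCharacterData
import Literature.NumberTheory.QuadraticFields.FundamentalDiscriminant
import Literature.NumberTheory.QuadraticFields.ImaginaryQuadraticPrescribedSplitting
import Literature.NumberTheory.EllipticCurves.KrizLi2019.ThreeClassNumbers
import HarnessLib

/-!
# Route `PrintCFram`, crux C2 `BottomClassIndexLawFiveLe` (stmt-BirchSwinnertonDyer-20372), line `eisenstein-resource-bdp-line`
# (registry v14): KIT for the HYPOTHESIS-FREE per-class class laws on the Kriz–Li locus — the Heegner field is CONSTRUCTED,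
# the `L`-value is DERIVED

Cell `bsd-print-cfram`, width seat `bsd-line-cfram-p1-w6` (generation g2); `--supports stmt-BirchSwinnertonDyer-20372` (helper).
THEOREMS ONLY (0 definitions, 0 named facts, 0 `sorry`); tree-only.

HONEST FRAMING. The crux C2 is CLASS-WIDE and stays OPEN; nothing about BSD is proved here; no summit statement is proved by this seat;
no stub is closed; everything is CONDITIONAL on the displayed named facts (prints5 = the five conjuncts of `stub_prints`; Kriz–Li 2019
Thm. 1.20).

WHAT IS PROVED. `bsdp_and_classLaw_of_blockAt`: for a class member `W` (CM, `CMRamified W p`, `p ≥ 5`, `r_an(W) = 1`) and a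
fundamental discriminant `D ≡ 1 (mod 4)`, `D < −4`, such that EVERY imaginary quadratic field `K''` of discriminant `D` is Heegner for
`N_W` and carries a Kriz–Li character block `(ψ, ω, ε_{K''})` of `W` at `p` with (4) — the shape in which the width seats' per-class
certificates are stated (w5 g0 `KrizLiBindersTwisted.exists_krizLiCharacterBlock_<label>`, `satisfiesHeegnerHypothesis_<label>`; w3 g2
`KrizLiBinders.exists_krizLiCharacterBlock_A{p}`) —, prints5 ∧ Kriz–Li Thm. 1.20 give `BSDp W p ∧ RamifiedCMBottomClassIndexLawAtZp W p`.
The field `K''` is CONSTRUCTED (`Quadratic.exists_numberField_discr_eq`, `Quadratic.isTotallyComplex_of_discr_neg`), so the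
per-class class laws built on this kit (files `…KrizLiLocusClassLaws{11,19,43and67andAnchors}`) carry NO field hypothesis, NO Heegner
point and NO `L`-value (`KrizLiLValueFree.bsdp_cmRamified_of_characterData_of_prints`, p663755 ∘ p662614 ∘ p662033 ∘ w7 g2's
p662184). §1: the field-existence helper `exists_isImaginaryQuadratic_discr_eq` (squarefreeness of the census discriminants via the tree's
`KrizLi2019.squarefree_neg_natCast` / `KrizLi2019.squarefree_mul_of_prime`). beyond-print theorem: NO. BSD is not proved by any of this.

References: [KrizLi2019] Thm. 1.20 (pp. 7–8), Rem. 1.21 (p. 8); [Cox2013] §1.C (fundamental discriminants); [Cremona1997] Table 1.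
-/

set_option autoImplicit false
-- `…BirchSwinnertonDyer.BirchSwinnertonDyer.Theorems…` is the problem's mandated namespace (D-0017).
set_option linter.dupNamespace false

noncomputable section

open scoped Classical

namespace Summit.BirchSwinnertonDyer.BirchSwinnertonDyer.Theorems.PrintCFram.KrizLiLValueFree

open WeierstrassCurve NumberField IsDedekindDomain Field
  Literature.NumberTheory.EllipticCurves Literature.NumberTheory.EllipticCurves.ModularForms
  Literature.NumberTheory.EllipticCurves.Rank1Residual Literature.NumberTheory.EllipticCurves.Rank1Residual.Typed
  Literature.NumberTheory.QuadraticFields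
  Summit.BirchSwinnertonDyer.BirchSwinnertonDyer.Theses.UniversalToricDescent
  Summit.BirchSwinnertonDyer.Rank1Residual Summit.BirchSwinnertonDyer.Rank1Residual.Additive
  Summit.BirchSwinnertonDyer.Rank1Residual.X12
  Summit.BirchSwinnertonDyer.BirchSwinnertonDyer.Theorems
  Summit.BirchSwinnertonDyer.BirchSwinnertonDyer.Theorems.PrintCFram

/-! ## §1 Field-existence helpers -/

/-- **An imaginary quadratic field of prescribed odd fundamental discriminant exists (as a Type).** For `D ≡ 1 (mod 4)`
squarefree and negative there is a number field `K` with `IsImaginaryQuadratic K` and `NumberField.discr K = D`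
(`Quadratic.exists_numberField_discr_eq` + `Quadratic.isTotallyComplex_of_discr_neg`). [cite: Cox2013, §1.C (Lemma 1.14 and (2.2))] -/
theorem exists_isImaginaryQuadratic_discr_eq {D : ℤ} (hD4 : D % 4 = 1) (hsq : Squarefree D) (hD0 : D < 0) :
    ∃ (K : Type) (_ : Field K) (_ : NumberField K), IsImaginaryQuadratic K ∧ NumberField.discr K = D := by
  obtain ⟨K, iF, iNF, hK2, hdK⟩ := Quadratic.exists_numberField_discr_eq (D := D) (Or.inl ⟨hD4, hsq, by omega⟩)
  exact ⟨K, iF, iNF, ⟨hK2, Quadratic.isTotallyComplex_of_discr_neg hK2 (hdK ▸ hD0)⟩, hdK⟩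

/-! ## §2 The class law from a per-discriminant character block -/

section Kit

variable {p : ℕ} [Fact p.Prime]

/-- **`BSD_p(W)` and the crux's conclusion from a CHARACTER BLOCK at a prescribed Heegner discriminant — hypothesis-free form.**
`W/ℚ` globally minimal with CM, `CMRamified W p`, `p ≥ 5`, `r_an(W) = 1`; `D ≡ 1 (mod 4)` squarefree with `D < −4`; and for EVERY
imaginary quadratic `K''` with `d_{K''} = D`: the Heegner hypothesis for `N_W` and a Kriz–Li character block `(ψ, ω, ε_{K''})` of `W`
at `p` (primitive `ψ`, Teichmüller `ω`, trace form, (1), (3), Kronecker character, (4)). THEN `BSDp W p ∧ RamifiedCMBottomClassIndexLawAtZp W p`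
modulo prints5 and Kriz–Li Thm. 1.20: the field is constructed (`exists_isImaginaryQuadratic_discr_eq`), and
`bsdp_cmRamified_of_characterData_of_prints` / `ramifiedCMBottomClassIndexLawAtZp_of_characterData_of_prints` apply (no Heegner
point, no `L`-value: p662033/p662614/p663755). CONDITIONAL on the named facts; closes nothing; BSD is not proved by any of this.
[cite: KrizLi2019, Thm. 1.20 (pp. 7–8), Rem. 1.21 (p. 8)] [cite: Cox2013, §1.C] -/
theorem bsdp_and_classLaw_of_blockAt
    (hprints : Hsieh2014.thmA_exists_isHsiehLFunction_unrPeriod_anyLevel ∧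
      LiuZhangZhang2018.thm151_thm153_modularCurve_heegnerVector_additive ∧
      ToricPublishedInputs ∧
      bsdTriple_of_hasCM_of_L_one_ne_zero ∧
      Literature.NumberTheory.NumberFields.MazurWiles1984.thm2_oddChiPart_classGroup_card_eq_pow_val_bernoulli)
    (hKL : KrizLi2019.thm120_padicLogHeegner_unit_of_bernoulli)
    (W : WeierstrassCurve ℚ) [W.IsElliptic] [W.IsGloballyMinimal] (hCM : W.HasCM) (hram : CMRamified W p) (h5 : 5 ≤ p)
    (hr : W.analyticRank = 1)
    (D : ℤ) (hD4 : D % 4 = 1) (hsq : Squarefree D) (hDlt : D < -4)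
    (hblock : ∀ (K : Type) [Field K] [NumberField K] [NeZero (NumberField.discr K).natAbs],
      Module.finrank ℚ K = 2 → NumberField.discr K = D →
      SatisfiesHeegnerHypothesis (W.conductorNorm ℤ) K ∧
      ∃ (f : ℕ) (_ : NeZero f) (ψ : DirichletCharacter ℚ_[p] f) (ω : DirichletCharacter ℚ_[p] p)
        (εK : DirichletCharacter ℚ_[p] (NumberField.discr K).natAbs),
        ψ.IsPrimitive ∧ KrizLi2019.IsTeichmullerCharacter ω ∧
        (∀ ℓ : ℕ, ℓ.Prime → ¬ (ℓ ∣ p * W.conductorNorm ℤ) →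
          ‖((W.LFunction ℓ : ℤ) : ℚ_[p]) - (ψ (ℓ : ZMod f) + ψ⁻¹ (ℓ : ZMod f) * ω (ℓ : ZMod p))‖ < 1) ∧
        (ψ (p : ZMod f) ≠ 1 ∧ KrizLi2019.primVal (KrizLi2019.invMulOmega ψ ω) p ≠ 1) ∧
        (∀ ℓ : ℕ, (hℓ : ℓ.Prime) → ℓ ≠ p →
          (haveI := Fact.mk hℓ; ¬ W.HasGoodReductionAtPrime ℓ ∧ ¬ W.HasMultiplicativeReductionAtPrime ℓ) →
          ψ (ℓ : ZMod f) ≠ 1 ∧ KrizLi2019.primVal (KrizLi2019.invMulOmega ψ ω) ℓ ≠ 1) ∧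
        KrizLi2019.IsKroneckerCharacterOf K εK ∧
        ¬ (‖KrizLi2019.bernoulliOnePrim (KrizLi2019.bernoulliCharOne ψ εK) *
            KrizLi2019.bernoulliOnePrim (KrizLi2019.bernoulliCharTwo ψ εK ω)‖ ≤ (p : ℝ)⁻¹)) :
    BSDp W p ∧ X12.O11.RamifiedCMBottomClassIndexLawAtZp W p := by
  obtain ⟨K, iF, iNF, hK, hdK⟩ := exists_isImaginaryQuadratic_discr_eq hD4 hsq (by omega)
  haveI : NeZero (NumberField.discr K).natAbs := ⟨Int.natAbs_ne_zero.mpr (NumberField.discr_ne_zero K)⟩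
  obtain ⟨hHN, f, hf, ψ, ω, εK, hψ, hω, hss, ⟨h1, h1'⟩, h3, hεK, h4⟩ := hblock K hK.1 hdK
  have hodd : Odd (NumberField.discr K) := by rw [hdK, Int.odd_iff]; omega
  have hd4 : NumberField.discr K < -4 := by rw [hdK]; exact hDlt
  exact ⟨bsdp_cmRamified_of_characterData_of_prints hprints hKL W hCM hram h5 hr K hK hHN hodd hd4 f ψ ω hψ hω hss h1 h1' h3
      εK hεK h4,
    ramifiedCMBottomClassIndexLawAtZp_of_characterData_of_prints hprints hKL W hCM hram h5 hr K hK hHN hodd hd4 f ψ ω hψ hω hss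
      h1 h1' h3 εK hεK h4⟩

end Kit

end Summit.BirchSwinnertonDyer.BirchSwinnertonDyer.Theorems.PrintCFram.KrizLiLValueFree

end
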